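import Summits.SmoothPoincare4.SmoothPoincare4.Theorems.ConvexBisectionAcyclicBisectionExistsHurwitzReduction
import Literature.Topology.FourManifolds.GluingProofs
import HarnessLib

/-!
# Stub `stub_modelsOnFibred_of_reach` (NF4), line `modp-braid-orbits`, crux
`ConvexBisection.AcyclicBisectionExists` (stmt-SmoothPoincare4-10508): the front stabilisation
from an X-slot rebuild statement, and NF4 from three X-slot statements

Companion of `ConvexBisectionAcyclicBisectionExistsHurwitzReduction.lean` ((HS) from (M2-T), and
(M2-T) from (M2-geo) ∧ (BELT)).

* §1 `frontStab_of_rebuild` / `helper_frontStab_of_rebuild` — **(ST-front) from (ST-geo)**: the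
  X-slot statement "fibred data `(X, h, D, bX, Ψ)` of `(g, l)` and a primitive-or-zero arc class `c`
  yield fibred data of `(g + 1, stabBlock g c ++ embed l)` over `Base (g + 1)` — a fresh Lefschetz
  handlebody with the four block handles in the pages of directions `pageDir (n+4) 0, …, 3` and the
  old handles re-spaced to `pageDir (n+4) (k+4)`, a fresh page-preserving gluing map — all of whose
  gluings are diffeomorphic to the gluings of the old data" (Etnyre–Fuller 2006 §2 p. 5 and Baykur
  2006 Lemma 1: two stabilisations of the seam open book = two cancelling pairs in a collar of the
  seam inside the cap, `M ≅ M # S⁴ # S⁴`; a REBUILD, not a deformation of the old cap: no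
  diffeomorphism of `Base g` re-spaces `≥ 4` page angles while keeping the page clause near the
  binding, where the angle map of a smooth binding-preserving map is projectively linear) gives
  (ST-front) verbatim: glue the new data (`exists_isBoundaryGluing_holds`), read off a fibred model of
  the glued manifold (`modelsOnFibred_of_data`), move it to `M` (`ModelsOnFibred.of_diffeomorph`).
* §2 `helper_modelsOnFibred_of_reach_of_nodes` — **the registered NF4 signature
  (= `LefschetzBase.modelsOnFibred_of_reach`) from the three X-slot statements (M2-geo), (BELT),
  (ST-geo)**, through `hurwitzStep_of_redecomposition`, `redecomposition_of_geometric_of_belt`,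
  `frontStab_of_rebuild` and p114135's `stub_modelsOnFibred_of_reach_of_front`.

References: J. B. Etnyre, T. Fuller, IMRN 2006, §2 [EtnyreFuller2006]; R. İ. Baykur, AGT 6 (2006),
§5 and Lemma 1 [Baykur2006]; R. E. Gompf, A. I. Stipsicz (1999), §8.2 [GompfStipsicz1999];
M. W. Hirsch, *Differential Topology* (1976), Ch. 8 §2 [HirschDT1976].
-/

noncomputable section

-- the prescribed namespace `Summit.<P>.<Sub>.…` duplicates `SmoothPoincare4` (P = Sub)
set_option linter.dupNamespace false

open scoped Manifold ContDiff Topology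
open Set Function

namespace Summit.SmoothPoincare4.SmoothPoincare4.Theorems.AcyclicBisectionExists.ModpBraidOrbits

open Literature.GroupTheory.CombinatorialGroupTheory.SignedHurwitz
open Literature.Topology.FourManifolds Literature.Topology.FourManifolds.LefschetzBase
open Literature.Topology.FourManifolds.HandleAttachingMap

namespace ModelsOnFibredOfReach

/-! ## §1 (ST-front) from the X-slot rebuild statement -/

/-- **(ST-front) from the rebuild statement (ST-geo).**  (ST-geo): fibred data
`(X, h, D, bX, Ψ)` of `(g, l)` and a primitive-or-zero arc class `c` yield fibred data
`(X', h', D', bX', Ψ')` of `(g + 1, stabBlock g c ++ embed l)` over `Base (g + 1)` — a fresh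
Lefschetz handlebody and a fresh page-preserving gluing map, the four block handles realised in the
pages of directions `pageDir (n+4) 0, …, 3` and the old ones re-spaced to `pageDir (n+4) (k+4)`
(Etnyre–Fuller 2006 §2 p. 5, Baykur 2006 Lemma 1: two stabilisations of the seam open book) — such
that every gluing of the old data is diffeomorphic to every gluing of the new data (the two
cancelling pairs live in a collar of the seam inside the cap: `M ≅ M # S⁴ # S⁴`, no
Laudenbach–Poénaru).  Then (ST-front) verbatim: glue the new data (`exists_isBoundaryGluing_holds`),
get a fibred model of the glued manifold (`modelsOnFibred_of_data`) and move it to `M`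
(`ModelsOnFibred.of_diffeomorph`, Hirsch 1976 §8.2). [cite: EtnyreFuller2006, §2] -/
theorem frontStab_of_rebuild
    (hST : ∀ (g : ℕ) (l : IntWord g) (c : Fin g ⊕ Fin g → ℤ), (c = 0 ∨ IsPrimitive c) →
      ∀ (X : Type) [TopologicalSpace X] [T2Space X] [SecondCountableTopology X] [CompactSpace X]
        [ChartedSpace (EuclideanHalfSpace 4) X] [IsManifold (𝓡∂ 4) ∞ X]
        (h : Fin l.length → HandleAttachingMap 3 2 (Base g))
        (D : MultiAttachmentData h (𝓡∂ 4) X) (bX : BoundaryData (𝓡∂ 4) X (𝓡 3))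
        (Ψ : bX.carrier ≃ₘ⟮𝓡 3, 𝓡 3⟯ (bBase g).carrier),
        IsLefschetzLink g l h →
        (∀ (y : bX.carrier) (a : ↥(coresComplement h)), bX.incl y = D.jA a →
          ∃ c : ℝ, 0 < c ∧ w g ((bBase g).incl (Ψ y)).1 = (c : ℂ) * w g (a : Base g).1) →
        ∃ (X' : Type) (_ : TopologicalSpace X') (_ : T2Space X') (_ : SecondCountableTopology X')
          (_ : CompactSpace X') (_ : ChartedSpace (EuclideanHalfSpace 4) X')
          (_ : IsManifold (𝓡∂ 4) ∞ X')
          (h' : Fin (stabBlock g c ++ mapWord (embed g) l).length →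
            HandleAttachingMap 3 2 (Base (g + 1)))
          (D' : MultiAttachmentData h' (𝓡∂ 4) X') (bX' : BoundaryData (𝓡∂ 4) X' (𝓡 3))
          (Ψ' : bX'.carrier ≃ₘ⟮𝓡 3, 𝓡 3⟯ (bBase (g + 1)).carrier),
          IsLefschetzLink (g + 1) (stabBlock g c ++ mapWord (embed g) l) h' ∧
          (∀ (y : bX'.carrier) (a : ↥(coresComplement h')), bX'.incl y = D'.jA a →
            ∃ c' : ℝ, 0 < c' ∧
              w (g + 1) ((bBase (g + 1)).incl (Ψ' y)).1 = (c' : ℂ) * w (g + 1) (a : Base (g + 1)).1) ∧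
          ∀ (M M' : Type) [TopologicalSpace M] [ChartedSpace (EuclideanSpace ℝ (Fin 4)) M]
            [IsManifold (𝓡 4) ∞ M] [TopologicalSpace M'] [ChartedSpace (EuclideanSpace ℝ (Fin 4)) M']
            [IsManifold (𝓡 4) ∞ M'],
            IsBoundaryGluing bX (bBase g) Ψ (𝓡 4) M → IsBoundaryGluing bX' (bBase (g + 1)) Ψ' (𝓡 4) M' →
            Nonempty (M ≃ₘ⟮𝓡 4, 𝓡 4⟯ M')) :
    ∀ (M : Type) [TopologicalSpace M] [T2Space M] [SecondCountableTopology M]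
      [ChartedSpace (EuclideanSpace ℝ (Fin 4)) M] [IsManifold (𝓡 4) ∞ M] (g : ℕ) (l : IntWord g)
      (c : Fin g ⊕ Fin g → ℤ), (c = 0 ∨ IsPrimitive c) → ModelsOnFibred M g l →
      ModelsOnFibred M (g + 1) (stabBlock g c ++ mapWord (embed g) l) := by
  intro M _ _ _ _ _ g l c hc hM
  obtain ⟨X, _, _, _, _, _, _, h, D, bX, Ψ, hlink, hglue, hpage⟩ := hM
  obtain ⟨X', _, _, _, _, _, _, h', D', bX', Ψ', hlink', hpage', hdiff⟩ :=
    hST g l c hc X h D bX Ψ hlink hpage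
  obtain ⟨P, _, _, _, _, _, _, hglueP⟩ := exists_isBoundaryGluing_holds bX' (bBase (g + 1)) Ψ'
  have hP : ModelsOnFibred P (g + 1) (stabBlock g c ++ mapWord (embed g) l) :=
    modelsOnFibred_of_data hlink' D' bX' Ψ' hglueP hpage'
  obtain ⟨e⟩ := hdiff M P hglue hglueP
  exact ModelsOnFibred.of_diffeomorph hP e.symm

end ModelsOnFibredOfReach

open ModelsOnFibredOfReach

/-- **(ST-front), registered form: fibred models survive one front stabilisation pair, GIVEN the
rebuild statement (ST-geo)** (`frontStab_of_rebuild`; Etnyre–Fuller 2006 §2 p. 5, Baykur 2006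
Lemma 1, gluing existence/uniqueness Hirsch 1976 §8.2). [cite: EtnyreFuller2006, §2] -/
theorem helper_frontStab_of_rebuild :
    (∀ (g : ℕ) (l : Literature.GroupTheory.CombinatorialGroupTheory.SignedHurwitz.IntWord g) (c :
      Fin g ⊕ Fin g → ℤ), (c = 0 ∨
      Literature.GroupTheory.CombinatorialGroupTheory.SignedHurwitz.IsPrimitive c) → ∀ (X : Type)
      [TopologicalSpace X] [T2Space X] [SecondCountableTopology X] [CompactSpace X] [ChartedSpace
      (EuclideanHalfSpace 4) X] [IsManifold (𝓡∂ 4) ∞ X] (h : Fin l.length →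
      Literature.Topology.FourManifolds.HandleAttachingMap 3 2
      (Literature.Topology.FourManifolds.LefschetzBase.Base g)) (D :
      Literature.Topology.FourManifolds.HandleAttachingMap.MultiAttachmentData h (𝓡∂ 4) X) (bX :
      Literature.Topology.FourManifolds.BoundaryData (𝓡∂ 4) X (𝓡 3)) (Ψ : bX.carrier ≃ₘ⟮𝓡 3, 𝓡 3⟯
      (Literature.Topology.FourManifolds.LefschetzBase.bBase g).carrier),
      Literature.Topology.FourManifolds.LefschetzBase.IsLefschetzLink g l h → (∀ (y : bX.carrier)
      (a : ↥(Literature.Topology.FourManifolds.HandleAttachingMap.coresComplement h)), bX.incl y =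
      D.jA a → ∃ c : ℝ, 0 < c ∧ Literature.Topology.FourManifolds.LefschetzBase.w g
      ((Literature.Topology.FourManifolds.LefschetzBase.bBase g).incl (Ψ y)).1 = (c : ℂ) *
      Literature.Topology.FourManifolds.LefschetzBase.w g (a :
      Literature.Topology.FourManifolds.LefschetzBase.Base g).1) → ∃ (X' : Type) (_ :
      TopologicalSpace X') (_ : T2Space X') (_ : SecondCountableTopology X') (_ : CompactSpace X')
      (_ : ChartedSpace (EuclideanHalfSpace 4) X') (_ : IsManifold (𝓡∂ 4) ∞ X') (h' : Fin
      (Literature.GroupTheory.CombinatorialGroupTheory.SignedHurwitz.stabBlock g c ++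
      Literature.GroupTheory.CombinatorialGroupTheory.SignedHurwitz.mapWord
      (Literature.GroupTheory.CombinatorialGroupTheory.SignedHurwitz.embed g) l).length →
      Literature.Topology.FourManifolds.HandleAttachingMap 3 2
      (Literature.Topology.FourManifolds.LefschetzBase.Base (g + 1))) (D' :
      Literature.Topology.FourManifolds.HandleAttachingMap.MultiAttachmentData h' (𝓡∂ 4) X') (bX'
      : Literature.Topology.FourManifolds.BoundaryData (𝓡∂ 4) X' (𝓡 3)) (Ψ' : bX'.carrier ≃ₘ⟮𝓡 3,
      𝓡 3⟯ (Literature.Topology.FourManifolds.LefschetzBase.bBase (g + 1)).carrier),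
      Literature.Topology.FourManifolds.LefschetzBase.IsLefschetzLink (g + 1)
      (Literature.GroupTheory.CombinatorialGroupTheory.SignedHurwitz.stabBlock g c ++
      Literature.GroupTheory.CombinatorialGroupTheory.SignedHurwitz.mapWord
      (Literature.GroupTheory.CombinatorialGroupTheory.SignedHurwitz.embed g) l) h' ∧ (∀ (y :
      bX'.carrier) (a : ↥(Literature.Topology.FourManifolds.HandleAttachingMap.coresComplement
      h')), bX'.incl y = D'.jA a → ∃ c' : ℝ, 0 < c' ∧
      Literature.Topology.FourManifolds.LefschetzBase.w (g + 1)
      ((Literature.Topology.FourManifolds.LefschetzBase.bBase (g + 1)).incl (Ψ' y)).1 = (c' : ℂ) *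
      Literature.Topology.FourManifolds.LefschetzBase.w (g + 1) (a :
      Literature.Topology.FourManifolds.LefschetzBase.Base (g + 1)).1) ∧ ∀ (M M' : Type)
      [TopologicalSpace M] [ChartedSpace (EuclideanSpace ℝ (Fin 4)) M] [IsManifold (𝓡 4) ∞ M]
      [TopologicalSpace M'] [ChartedSpace (EuclideanSpace ℝ (Fin 4)) M'] [IsManifold (𝓡 4) ∞ M'],
      Literature.Topology.FourManifolds.IsBoundaryGluing bX
      (Literature.Topology.FourManifolds.LefschetzBase.bBase g) Ψ (𝓡 4) M →
      Literature.Topology.FourManifolds.IsBoundaryGluing bX'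
      (Literature.Topology.FourManifolds.LefschetzBase.bBase (g + 1)) Ψ' (𝓡 4) M' → Nonempty (M
      ≃ₘ⟮𝓡 4, 𝓡 4⟯ M')) → ∀ (M : Type) [TopologicalSpace M] [T2Space M] [SecondCountableTopology
      M] [ChartedSpace (EuclideanSpace ℝ (Fin 4)) M] [IsManifold (𝓡 4) ∞ M] (g : ℕ) (l :
      Literature.GroupTheory.CombinatorialGroupTheory.SignedHurwitz.IntWord g) (c : Fin g ⊕ Fin g
      → ℤ), (c = 0 ∨ Literature.GroupTheory.CombinatorialGroupTheory.SignedHurwitz.IsPrimitive c)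
      → Literature.Topology.FourManifolds.LefschetzBase.ModelsOnFibred M g l →
      Literature.Topology.FourManifolds.LefschetzBase.ModelsOnFibred M (g + 1)
      (Literature.GroupTheory.CombinatorialGroupTheory.SignedHurwitz.stabBlock g c ++
      Literature.GroupTheory.CombinatorialGroupTheory.SignedHurwitz.mapWord
      (Literature.GroupTheory.CombinatorialGroupTheory.SignedHurwitz.embed g) l) :=
  fun hST => frontStab_of_rebuild hST

/-! ## §2 The registered NF4 signature from the three X-slot statements -/

/-- **NF4 (`stub_modelsOnFibred_of_reach` = `LefschetzBase.modelsOnFibred_of_reach`) from the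
three X-slot statements (M2-geo), (BELT), (ST-geo)** — the geometric one-move Hurwitz
re-decomposition in transfer form, the belt clause, and the stabilisation rebuild — via
`hurwitzStep_of_redecomposition`, `redecomposition_of_geometric_of_belt`, `frontStab_of_rebuild` and
p114135's `stub_modelsOnFibred_of_reach_of_front` (`Reach` is generated by signed Hurwitz moves and
front stabilisations).  Conclusion: the registered signature verbatim.  Gompf–Stipsicz 1999 §8.2,
Baykur 2006 §5 p. 13 and Lemma 1, Etnyre–Fuller 2006 §2. [cite: Baykur2006, Lemma 1 and §5 p. 13] -/
theorem helper_modelsOnFibred_of_reach_of_nodes :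
    (∀ (g : ℕ) (l l' : IntWord g), HurwitzStep (stdSymp ℤ g) l l' →
      ∀ (X : Type) [TopologicalSpace X] [T2Space X] [SecondCountableTopology X] [CompactSpace X]
        [ChartedSpace (EuclideanHalfSpace 4) X] [IsManifold (𝓡∂ 4) ∞ X]
        (h : Fin l.length → HandleAttachingMap 3 2 (Base g))
        (D : MultiAttachmentData h (𝓡∂ 4) X) (bX : BoundaryData (𝓡∂ 4) X (𝓡 3))
        (Ψ : bX.carrier ≃ₘ⟮𝓡 3, 𝓡 3⟯ (bBase g).carrier),
        IsLefschetzLink g l h →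
        (∀ (y : bX.carrier) (a : ↥(coresComplement h)), bX.incl y = D.jA a →
          ∃ c : ℝ, 0 < c ∧ w g ((bBase g).incl (Ψ y)).1 = (c : ℂ) * w g (a : Base g).1) →
        ∃ (X' : Type) (_ : TopologicalSpace X') (_ : T2Space X') (_ : SecondCountableTopology X')
          (_ : CompactSpace X') (_ : ChartedSpace (EuclideanHalfSpace 4) X')
          (_ : IsManifold (𝓡∂ 4) ∞ X') (h' : Fin l'.length → HandleAttachingMap 3 2 (Base g))
          (D' : MultiAttachmentData h' (𝓡∂ 4) X') (G : X ≃ₘ⟮𝓡∂ 4, 𝓡∂ 4⟯ X'),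
          IsLefschetzLink g l' h' ∧
          ∀ a' : ↥(coresComplement h'), G.symm (D'.jA a') ∈ (𝓡∂ 4).boundary X →
            (∃ a : ↥(coresComplement h), G.symm (D'.jA a') = D.jA a ∧
              ∃ c : ℝ, 0 < c ∧ w g (a' : Base g).1 = (c : ℂ) * w g (a : Base g).1) ∨
            (∃ (k : Fin l.length) (b : ↥(beltPiece 3 2)), G.symm (D'.jA a') = D.jB k b ∧
              G.symm (D'.jA a') ∉ range D.jA ∧
              ∃ c : ℝ, 0 < c ∧ w g (a' : Base g).1 = (c : ℂ) * pageDir l.length k)) →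
    (∀ (g : ℕ) (l : IntWord g) (X : Type) [TopologicalSpace X] [T2Space X]
      [SecondCountableTopology X] [CompactSpace X] [ChartedSpace (EuclideanHalfSpace 4) X]
      [IsManifold (𝓡∂ 4) ∞ X] (h : Fin l.length → HandleAttachingMap 3 2 (Base g))
      (D : MultiAttachmentData h (𝓡∂ 4) X) (bX : BoundaryData (𝓡∂ 4) X (𝓡 3))
      (Ψ : bX.carrier ≃ₘ⟮𝓡 3, 𝓡 3⟯ (bBase g).carrier),
      IsLefschetzLink g l h →
      (∀ (y : bX.carrier) (a : ↥(coresComplement h)), bX.incl y = D.jA a →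
        ∃ c : ℝ, 0 < c ∧ w g ((bBase g).incl (Ψ y)).1 = (c : ℂ) * w g (a : Base g).1) →
      ∀ (y : bX.carrier) (k : Fin l.length) (b : ↥(beltPiece 3 2)), bX.incl y = D.jB k b →
        bX.incl y ∉ range D.jA →
        ∃ c : ℝ, 0 < c ∧ w g ((bBase g).incl (Ψ y)).1 = (c : ℂ) * pageDir l.length k) →
    (∀ (g : ℕ) (l : IntWord g) (c : Fin g ⊕ Fin g → ℤ), (c = 0 ∨ IsPrimitive c) →
      ∀ (X : Type) [TopologicalSpace X] [T2Space X] [SecondCountableTopology X] [CompactSpace X]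
        [ChartedSpace (EuclideanHalfSpace 4) X] [IsManifold (𝓡∂ 4) ∞ X]
        (h : Fin l.length → HandleAttachingMap 3 2 (Base g))
        (D : MultiAttachmentData h (𝓡∂ 4) X) (bX : BoundaryData (𝓡∂ 4) X (𝓡 3))
        (Ψ : bX.carrier ≃ₘ⟮𝓡 3, 𝓡 3⟯ (bBase g).carrier),
        IsLefschetzLink g l h →
        (∀ (y : bX.carrier) (a : ↥(coresComplement h)), bX.incl y = D.jA a →
          ∃ c : ℝ, 0 < c ∧ w g ((bBase g).incl (Ψ y)).1 = (c : ℂ) * w g (a : Base g).1) →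
        ∃ (X' : Type) (_ : TopologicalSpace X') (_ : T2Space X') (_ : SecondCountableTopology X')
          (_ : CompactSpace X') (_ : ChartedSpace (EuclideanHalfSpace 4) X')
          (_ : IsManifold (𝓡∂ 4) ∞ X')
          (h' : Fin (stabBlock g c ++ mapWord (embed g) l).length →
            HandleAttachingMap 3 2 (Base (g + 1)))
          (D' : MultiAttachmentData h' (𝓡∂ 4) X') (bX' : BoundaryData (𝓡∂ 4) X' (𝓡 3))
          (Ψ' : bX'.carrier ≃ₘ⟮𝓡 3, 𝓡 3⟯ (bBase (g + 1)).carrier),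
          IsLefschetzLink (g + 1) (stabBlock g c ++ mapWord (embed g) l) h' ∧
          (∀ (y : bX'.carrier) (a : ↥(coresComplement h')), bX'.incl y = D'.jA a →
            ∃ c' : ℝ, 0 < c' ∧
              w (g + 1) ((bBase (g + 1)).incl (Ψ' y)).1 = (c' : ℂ) * w (g + 1) (a : Base (g + 1)).1) ∧
          ∀ (M M' : Type) [TopologicalSpace M] [ChartedSpace (EuclideanSpace ℝ (Fin 4)) M]
            [IsManifold (𝓡 4) ∞ M] [TopologicalSpace M'] [ChartedSpace (EuclideanSpace ℝ (Fin 4)) M']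
            [IsManifold (𝓡 4) ∞ M'],
            IsBoundaryGluing bX (bBase g) Ψ (𝓡 4) M → IsBoundaryGluing bX' (bBase (g + 1)) Ψ' (𝓡 4) M' →
            Nonempty (M ≃ₘ⟮𝓡 4, 𝓡 4⟯ M')) →
    ∀ (M : Type) [TopologicalSpace M] [T2Space M] [SecondCountableTopology M]
      [ChartedSpace (EuclideanSpace ℝ (Fin 4)) M] [IsManifold (𝓡 4) ∞ M] (g : ℕ) (l : IntWord g)
      (g' : ℕ) (l' : IntWord g'),
      ModelsOnFibred M g l → Reach g l g' l' → ModelsOnFibred M g' l' :=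
  fun hgeo hbelt hST =>
    stub_modelsOnFibred_of_reach_of_front
      (hurwitzStep_of_redecomposition (redecomposition_of_geometric_of_belt hgeo hbelt))
      (frontStab_of_rebuild hST)

end Summit.SmoothPoincare4.SmoothPoincare4.Theorems.AcyclicBisectionExists.ModpBraidOrbits

end
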